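/-
Copyright: cell `pub-ymgap` (HUMAN RULING D-0062), Track A of `YM-PLAN.md`, DAG node N20 (= NE7b); R134 seat `pub-ymgap-dag-n20-d`
(strategy s3 «alternative currency», generation 5), module 3.  Released under the licence of the surrounding project.
-/
import Summits.QuantumFields.YangMills.Theorems.BalabanUVNodesN20ByValueExtraction
import Literature.MathematicalPhysics.QuantumFieldTheory.Balaban1983to89.Node00.CanonicalTransportOfRecord
import Literature.MathematicalPhysics.QuantumFieldTheory.Balaban1983to89.MissingProofs

/-!
# YM-DAG node N20 (= NE7b), strategy s3, THE FOURTH CURRENCY «BY VALUE» (module 3): RENORMALISATION TRANSFORMATIONS IN THE CELL'S SENSE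
# `Setup.IsRT` ARE MODULE STEPS — hence NODE 00's transports of record `Node00.TrhoOfRecord` ∕ `Node00.TcanOfRecord` are — and the per-class
# display of the (α) road on a tower of such steps over the `K`-th torus follows from ONE joint-sparseness inequality for the ITERATED AVERAGED
# FIELDS OF RECORD `Averaging.iter (Node00.avOfRecord F N K) k U` under the level-0 state `ρ₀·dU`

Track A of `YM-PLAN.md` (cell `pub-ymgap`, HUMAN RULING D-0062), node **N20** = spine estimate NE7b (`T4WeightBudget.RelWeightBound` — the cell
`pub-balaban`'s OWN estimate, NOT PRINTED in [Bałaban 1983–89], NOT PROVED).  Seat `pub-ymgap-dag-n20-d` (R134, s3), generation 5, module 3 after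
`…N20ByValueTelescoping` (p496513: `pullAlong`, `integral_mul_eterm_eq_pullAlong`) and `…N20ByValueExtraction` (p497227: the display from (JS)∕(JM),
`hmod_of_kernelTransport`).  Kernel theorems only: 0 `def`, 0 `sorry`, standard axioms; COUNT-NEUTRAL (`--supports` K3‴ `SpineGivenEndpointR13`,
stmt-QuantumFields-19912, `--as helper`).  Restate-immune (no Theses import, no ∃-currency module).

THE POINT.  Modules 1–2 display the MODULE PROPERTY `hmod` of a tower abstractly and discharge it for ops acting as the disintegration transport
`T4AveragingDisintegration.kernelTransport`.  The cell's OWN definition of a renormalisation transformation is the push-forward reading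
`Setup.IsRT avg ρ ρ' : ∀ f bounded measurable, ∫ ρ'·f dV = ∫ ρ·(f ∘ avg) dU` ([Balaban1985Averaging] (10) p. 19, DIVERGENCE F7) — and THAT IS the module
identity for the pair `(χ·f, op f)`.  So:
* §1 `hmod_of_isRT`: over gauge-field levels `GaugeField P j G` with the product Haar measures `fieldMeasure P j G`, ANY tower whose admissible one-step
  operations satisfy `IsRT (avg j) (χ_{j,g,p}·f) ((op j g p).T f)` for the good `f` of a class finer than bounded-measurable (`hGd`) is a MODULE tower
  (`hmod` of module 1, `μ j := fieldMeasure P j G`) — one line of commutativity;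
* §2 AT NODE 00's RECORD on the `K`-th torus (`P := F.P K`, `G := SU N`, `avg k := (Node00.avOfRecord F N K k).avg`): a tower whose admissible operations
  (at steps `k < K`) ACT AS the Radon–Nikodym transport of record `Node00.TrhoOfRecord F N K k (χ·f)` (`hmod_of_TrhoOfRecord`, by def-T's
  `Node00.isRT_TrhoOfRecord`) or AS the canonical-version transport of record `Node00.TcanOfRecord F N K k (χ·f)` (`hmod_of_TcanOfRecord`, by K0e's
  `Node00.isRT_TcanOfRecord` — «ALWAYS a renormalisation transformation of every integrable ρ») IS a module tower; `iterMap_avg_eq_iter`: module 1's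
  iterated level map over `(av k).avg` IS the tree's `Averaging.iter av` (so the pulled-back letters read the ITERATED AVERAGED FIELD OF RECORD
  `Ū^k = Averaging.iter (avOfRecord F N K) k U` of n21-c's Prop. 2 ∕ this lineage's `iter_avOfRecord_qsstarGIter0`);
* §3 ★ `sum_admS_integral_le_mul_sum_adm_ofRecord`: for such a tower at the record (canonical transport), the decomposition of unity, pinned-sum letters
  `e_k` and the ONE inequality
    (JS)_rec `∫ (Π_{k<K'} e_k(Ū^k(U)))·ρ₀(U) dU ≤ q·∫ ρ₀ dU`   (`dU = fieldMeasure (F.P K) 0 (SU N)`, `Ū^k = Averaging.iter (avOfRecord F N K) k U`)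
  give the `extract`-shaped display `Σ_{admS K'} ∫ eterm K' h ≤ q·Σ_{adm K'} ∫ eterm K' h` (module 2's `sum_admS_integral_le_mul_sum_adm_byValue` with `hmod`
  DISCHARGED) — in this currency NE7b's per-class residual at the record is a joint large-deviation bound for Bałaban's iterated block averages of the
  level-0 field under `ρ₀·dU`, and nothing conditional.

HONEST FRAMING.  Count-neutral kernel bookkeeping [folklore].  The hypothesis `hop` («the admissible operations act as `TcanOfRecord (χ·f)` on the good
class») presupposes a good class MAPPED INTO ITSELF by the transport — for the bounded-measurable class this is the marginal-density letter of gaps-ne6's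
`StepKernelOfMap` §2b (`dU.map avg ≤ C • dV`), NOT discharged here; no tower of Bałaban's is constructed or claimed (the (A1c) object; NC-NE7b-α UNRULED);
(JS)_rec for pins at several levels is NOT in the tree and NOT printed as a statement; nothing of Bałaban's is asserted, valued or instantiated; NE7b NOT
PRINTED ∕ NOT PROVED; the (α)-instance 0∕1; N20 NOT discharged (typed 28∕28, discharged count untouched); one finite four-torus programme at fixed `ε` — NOT
ℝ⁴, NOT infinite volume, NOT OS, NOT a mass gap, NOT Clay.  References (LOCATORS only; no decl carries a cite tag): T. Bałaban, CMP **98** (1985) 17–51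
[Balaban1985Averaging] ((10) p. 19); CMP **109** (1987) [Balaban1987RG1] ((0.11) p. 253); CMP **122** (1989) 175–202 [Balaban1989LargeFieldI] ((0.4) p. 176).
-/

set_option autoImplicit false

noncomputable section

open Finset MeasureTheory
open Summit.QuantumFields.BalabanUV.T4Continuum.B16HistoryIndexedRepr
open Summit.QuantumFields.BalabanUV.T4Continuum.B16HistoryReprChain
open Summit.QuantumFields.BalabanUV.T4Continuum.NE7b.PrefixExtraction (admS)
open Summit.QuantumFields.BalabanUV.T4Continuum.ShellMeasureAverageIterate (iterMap iterMap_zero iterMap_succ)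
open Summit.QuantumFields.YangMills.BalabanUVNodes.N20ByValueTelescoping
open Summit.QuantumFields.YangMills.BalabanUVNodes.N20ByValueExtraction
open Literature.MathematicalPhysics.QuantumFieldTheory.Balaban1983to89
open Literature.MathematicalPhysics.QuantumFieldTheory.Balaban1983to89.Missing (isProbabilityMeasure_fieldMeasure)
open Literature.MathematicalPhysics.QuantumFieldTheory.Balaban1983to89.T4Continuum (T4Family)
open Literature.MathematicalPhysics.QuantumFieldTheory.Balaban1983to89.Node00 (SU avOfRecord TrhoOfRecord TcanOfRecord isRT_TrhoOfRecord isRT_TcanOfRecord)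

namespace Summit.QuantumFields.YangMills.BalabanUVNodes.N20ByValueAtRecord

/-! ## §1 Renormalisation transformations in the cell's sense `Setup.IsRT` are module steps -/

section IsRTJunction

variable {Pℓ : Type} {P : Params} {G : Type} [GaugeGroup G] [MeasurableSpace G] [HaarData G]
  {𝒢 : (j : ℕ) → GoodClass (GaugeField P j G)} (T : Tower Pℓ (fun j => GaugeField P j G) 𝒢)
  (avg : (j : ℕ) → GaugeField P j G → GaugeField P (j + 1) G) (χ : (j : ℕ) → (Fin j → Pℓ) → Pℓ → GaugeField P j G → ℝ)

/-- **RENORMALISATION TRANSFORMATIONS ARE MODULE STEPS.**  On gauge-field levels with the product Haar measures, if the good class is finer than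
bounded-measurable (`hGd`) and every admissible one-step operation applied to a good `f` IS a renormalisation transform of `χ_{j,g,p}·f` along `avg j` in
the cell's sense — `Setup.IsRT (avg j) (χ_{j,g,p}·f) ((op j g p).T f)`, the push-forward reading `∫ (Tρ)·m dV = ∫ ρ·(m ∘ avg) dU` for bounded measurable
`m` — then the tower has module 1's MODULE PROPERTY with `μ j := fieldMeasure P j G`. [folklore] -/
theorem hmod_of_isRT (hGd : ∀ (j : ℕ) (f : GaugeField P j G → ℝ), (𝒢 j).Gd f → Measurable f ∧ ∃ C : ℝ, ∀ x, |f x| ≤ C)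
    (hRT : ∀ (j : ℕ) (g : Fin j → Pℓ) (p : Pℓ), g ∈ T.adm j → p ∈ T.branch j g → ∀ f : GaugeField P j G → ℝ, (𝒢 j).Gd f →
      IsRT (avg j) (fun U => χ j g p U * f U) ((T.op j g p).T f)) :
    ∀ (j : ℕ) (g : Fin j → Pℓ) (p : Pℓ), g ∈ T.adm j → p ∈ T.branch j g →
      ∀ (m : GaugeField P (j + 1) G → ℝ) (f : GaugeField P j G → ℝ), (𝒢 (j + 1)).Gd m → (𝒢 j).Gd f →
        ∫ x, m x * (T.op j g p).T f x ∂fieldMeasure P (j + 1) G = ∫ y, m (avg j y) * (χ j g p y * f y) ∂fieldMeasure P j G := by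
  intro j g p hg hp m f hm hf
  obtain ⟨hmm, B, hB⟩ := hGd (j + 1) m hm
  have h := hRT j g p hg hp f hf m hmm ⟨B, hB⟩
  have e1 : (fun x => m x * (T.op j g p).T f x) = fun x => (T.op j g p).T f x * m x := funext fun x => mul_comm _ _
  have e2 : (fun y => m (avg j y) * (χ j g p y * f y)) = fun y => (χ j g p y * f y) * m (avg j y) := funext fun y => mul_comm _ _
  rw [e1, e2]
  exact h

omit [MeasurableSpace G] [HaarData G] in
/-- **MODULE 1's ITERATED LEVEL MAP OVER ONE-STEP AVERAGINGS IS THE TREE's `Averaging.iter`** (`Ū^k = M^k(U)`, [Balaban1987RG1] (0.11) p. 253): the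
pulled-back letters of modules 1–2 read the iterated averaged field. [folklore] -/
theorem iterMap_avg_eq_iter (av : (j : ℕ) → Averaging P j G) :
    ∀ k : ℕ, iterMap (E := fun j => GaugeField P j G) (fun j => (av j).avg) k = Averaging.iter av k
  | 0 => rfl
  | k + 1 => by
      show (av k).avg ∘ iterMap (E := fun j => GaugeField P j G) (fun j => (av j).avg) k = (av k).avg ∘ Averaging.iter av k
      rw [iterMap_avg_eq_iter av k]

end IsRTJunction

/-! ## §2 At NODE 00's record on the `K`-th torus: towers of transports of record are module towers -/

section Record

variable {F : T4Family} {N : ℕ} [NeZero N] {Pℓ : Type} [DecidableEq Pℓ] (K : ℕ)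
  {𝒢 : (k : ℕ) → GoodClass (GaugeField (F.P K) k (SU N))} (T : Tower Pℓ (fun k => GaugeField (F.P K) k (SU N)) 𝒢)
  (χ : (k : ℕ) → (Fin k → Pℓ) → Pℓ → GaugeField (F.P K) k (SU N) → ℝ)

omit [DecidableEq Pℓ] in
/-- Good functions of a class finer than bounded-measurable are integrable under the (probability) product Haar measure of a level. [folklore] -/
theorem integrable_of_good (hGd : ∀ (k : ℕ) (f : GaugeField (F.P K) k (SU N) → ℝ), (𝒢 k).Gd f → Measurable f ∧ ∃ C : ℝ, ∀ x, |f x| ≤ C)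
    (k : ℕ) {f : GaugeField (F.P K) k (SU N) → ℝ} (hf : (𝒢 k).Gd f) : Integrable f (fieldMeasure (F.P K) k (SU N)) := by
  haveI := isProbabilityMeasure_fieldMeasure (G := SU N) (F.P K) k
  obtain ⟨hm, C, hC⟩ := hGd k f hf
  exact Integrable.of_bound hm.aestronglyMeasurable C (Filter.Eventually.of_forall fun x => by rw [Real.norm_eq_abs]; exact hC x)

omit [DecidableEq Pℓ] in
/-- **A TOWER OF RADON–NIKODYM TRANSPORTS OF RECORD IS A MODULE TOWER.**  If every admissible one-step operation (steps `k < K`) ACTS on the good class AS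
def-T's transport of record `Node00.TrhoOfRecord F N K k` applied to `χ_{k,g,p}·f` (with `χ_{k,g,p}` good), then — `Node00.isRT_TrhoOfRecord`: it IS a
renormalisation transform of every integrable density along `(avOfRecord F N K k).avg` — the tower has the module property with `μ k := fieldMeasure`,
`avg k := (avOfRecord F N K k).avg`. [folklore] -/
theorem hmod_of_TrhoOfRecord (hGd : ∀ (k : ℕ) (f : GaugeField (F.P K) k (SU N) → ℝ), (𝒢 k).Gd f → Measurable f ∧ ∃ C : ℝ, ∀ x, |f x| ≤ C)
    (hχ : ∀ k g p, (𝒢 k).Gd (χ k g p))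
    (hop : ∀ (k : ℕ) (g : Fin k → Pℓ) (p : Pℓ), g ∈ T.adm k → p ∈ T.branch k g →
      k < K ∧ ∀ f : GaugeField (F.P K) k (SU N) → ℝ, (𝒢 k).Gd f → (T.op k g p).T f = TrhoOfRecord F N K k (fun U => χ k g p U * f U)) :
    ∀ (k : ℕ) (g : Fin k → Pℓ) (p : Pℓ), g ∈ T.adm k → p ∈ T.branch k g →
      ∀ (m : GaugeField (F.P K) (k + 1) (SU N) → ℝ) (f : GaugeField (F.P K) k (SU N) → ℝ), (𝒢 (k + 1)).Gd m → (𝒢 k).Gd f →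
        ∫ x, m x * (T.op k g p).T f x ∂fieldMeasure (F.P K) (k + 1) (SU N) =
          ∫ y, m ((avOfRecord F N K k).avg y) * (χ k g p y * f y) ∂fieldMeasure (F.P K) k (SU N) :=
  hmod_of_isRT T (fun k => (avOfRecord F N K k).avg) χ hGd fun k g p hg hp f hf => by
    obtain ⟨hk, hopf⟩ := hop k g p hg hp
    rw [hopf f hf]
    exact isRT_TrhoOfRecord F N K k hk _ (integrable_of_good K hGd k ((𝒢 k).mul (hχ k g p) hf))

omit [DecidableEq Pℓ] in
/-- **A TOWER OF CANONICAL TRANSPORTS OF RECORD IS A MODULE TOWER.**  The same with K0e's canonical-version transport `Node00.TcanOfRecord F N K k` — «ALWAYS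
a renormalisation transformation of every integrable `ρ`, `k < K`» (`Node00.isRT_TcanOfRecord`), the transport the Stage-13 record's β reads. [folklore] -/
theorem hmod_of_TcanOfRecord (hGd : ∀ (k : ℕ) (f : GaugeField (F.P K) k (SU N) → ℝ), (𝒢 k).Gd f → Measurable f ∧ ∃ C : ℝ, ∀ x, |f x| ≤ C)
    (hχ : ∀ k g p, (𝒢 k).Gd (χ k g p))
    (hop : ∀ (k : ℕ) (g : Fin k → Pℓ) (p : Pℓ), g ∈ T.adm k → p ∈ T.branch k g →
      k < K ∧ ∀ f : GaugeField (F.P K) k (SU N) → ℝ, (𝒢 k).Gd f → (T.op k g p).T f = TcanOfRecord F N K k (fun U => χ k g p U * f U)) :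
    ∀ (k : ℕ) (g : Fin k → Pℓ) (p : Pℓ), g ∈ T.adm k → p ∈ T.branch k g →
      ∀ (m : GaugeField (F.P K) (k + 1) (SU N) → ℝ) (f : GaugeField (F.P K) k (SU N) → ℝ), (𝒢 (k + 1)).Gd m → (𝒢 k).Gd f →
        ∫ x, m x * (T.op k g p).T f x ∂fieldMeasure (F.P K) (k + 1) (SU N) =
          ∫ y, m ((avOfRecord F N K k).avg y) * (χ k g p y * f y) ∂fieldMeasure (F.P K) k (SU N) :=
  hmod_of_isRT T (fun k => (avOfRecord F N K k).avg) χ hGd fun k g p hg hp f hf => by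
    obtain ⟨hk, hopf⟩ := hop k g p hg hp
    rw [hopf f hf]
    exact isRT_TcanOfRecord hk (integrable_of_good K hGd k ((𝒢 k).mul (hχ k g p) hf))

/-! ## §3 The per-class display AT THE RECORD from ONE joint-sparseness inequality for the iterated averaged fields of record -/

/-- **THE (α) ROAD's PER-CLASS DISPLAY AT NODE 00's RECORD, BY VALUE.**  On the `K`-th torus, let a history tower over the gauge-field levels
`GaugeField (F.P K) k (SU N)` have admissible one-step operations (steps `k < K`) acting as the canonical transport of record on `χ_{k,g,p}·f` (good class
finer than bounded-measurable, mapped by pull-back along the averaging of record — `havg`), non-negative good characteristic functions with the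
decomposition of unity, and pinned-sum letters `Σ_{p ∈ branch ∩ S} χ_{k,g,p} ≤ e_k` (good, `≥ 0`) at the pattern's prefixes below `K'`.  Then the ONE
inequality
  (JS)_rec `∫ (Π_{k<K'} e_k(Ū^k(U)))·ρ₀(U) dU ≤ q·∫ ρ₀ dU`,  `Ū^k = Averaging.iter (avOfRecord F N K) k`, `dU = fieldMeasure (F.P K) 0 (SU N)`,
— the joint sparseness of the pinned letters of ALL pinned levels read on BAŁABAN's ITERATED BLOCK AVERAGES OF THE LEVEL-0 FIELD, under the level-0 state
`ρ₀·dU` — gives `Σ_{h ∈ admS K'} ∫ eterm K' h ≤ q·Σ_{h ∈ adm K'} ∫ eterm K' h` (module 2 with `hmod` DISCHARGED by §2). [folklore] -/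
theorem sum_admS_integral_le_mul_sum_adm_ofRecord (S : (k : ℕ) → (Fin k → Pℓ) → Finset Pℓ)
    (e : (k : ℕ) → GaugeField (F.P K) k (SU N) → ℝ)
    (hGd : ∀ (k : ℕ) (f : GaugeField (F.P K) k (SU N) → ℝ), (𝒢 k).Gd f → Measurable f ∧ ∃ C : ℝ, ∀ x, |f x| ≤ C)
    (havg : ∀ (k : ℕ) (m : GaugeField (F.P K) (k + 1) (SU N) → ℝ), (𝒢 (k + 1)).Gd m → (𝒢 k).Gd fun y => m ((avOfRecord F N K k).avg y))
    (hχ : ∀ k g p, (𝒢 k).Gd (χ k g p)) (hχ0 : ∀ k g p y, 0 ≤ χ k g p y)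
    (hop : ∀ (k : ℕ) (g : Fin k → Pℓ) (p : Pℓ), g ∈ T.adm k → p ∈ T.branch k g →
      k < K ∧ ∀ f : GaugeField (F.P K) k (SU N) → ℝ, (𝒢 k).Gd f → (T.op k g p).T f = TcanOfRecord F N K k (fun U => χ k g p U * f U))
    (hunit : ∀ (k : ℕ) (g : Fin k → Pℓ), g ∈ T.adm k → ∀ y, ∑ p ∈ T.branch k g, χ k g p y = 1)
    {ρ₀ : GaugeField (F.P K) 0 (SU N) → ℝ} (hρ : (𝒢 0).Gd ρ₀) (h0 : ∀ U, 0 ≤ ρ₀ U)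
    (he : ∀ k y, 0 ≤ e k y) (heg : ∀ k, (𝒢 k).Gd (e k)) (K' : ℕ)
    (hpin : ∀ (k : ℕ) (g : Fin k → Pℓ), k < K' → g ∈ admS T S k → ∀ y, ∑ p ∈ T.branch k g ∩ S k g, χ k g p y ≤ e k y) {q : ℝ}
    (hJS : ∫ U, (∏ k ∈ Finset.range K', e k (Averaging.iter (avOfRecord F N K) k U)) * ρ₀ U ∂fieldMeasure (F.P K) 0 (SU N) ≤
      q * ∫ U, ρ₀ U ∂fieldMeasure (F.P K) 0 (SU N)) :
    ∑ h ∈ admS T S K', ∫ x, T.eterm ρ₀ K' h x ∂fieldMeasure (F.P K) K' (SU N) ≤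
      q * ∑ h ∈ T.adm K', ∫ x, T.eterm ρ₀ K' h x ∂fieldMeasure (F.P K) K' (SU N) := by
  have hJS' : ∫ U, (∏ k ∈ Finset.range K', e k (iterMap (E := fun j => GaugeField (F.P K) j (SU N))
      (fun k => (avOfRecord F N K k).avg) k U)) * ρ₀ U ∂fieldMeasure (F.P K) 0 (SU N) ≤ q * ∫ U, ρ₀ U ∂fieldMeasure (F.P K) 0 (SU N) := by
    simpa only [iterMap_avg_eq_iter] using hJS
  exact sum_admS_integral_le_mul_sum_adm_byValue T (fun k => fieldMeasure (F.P K) k (SU N)) (fun k => (avOfRecord F N K k).avg) χ S e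
    havg hχ hχ0 (hmod_of_TcanOfRecord K T χ hGd hχ hop) hunit hρ h0 (fun f hf => integrable_of_good K hGd 0 hf) he heg K' hpin hJS'

end Record

end Summit.QuantumFields.YangMills.BalabanUVNodes.N20ByValueAtRecord
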